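import Summits.QuantumFields.BalabanUV.T4Continuum.Support.NE3SlicePoincareRemainderE
import Summits.QuantumFields.BalabanUV.T4Continuum.Support.NE3FramePotBoundWSharp
import Summits.QuantumFields.BalabanUV.T4Continuum.Support.NE3NestedBlockMeanJensenHS
import Summits.QuantumFields.BalabanUV.T4Continuum.Support.NE3CovariantLineSumGauge
import HarnessLib

/-!
# NE3SlicePoincareCoarseData (T⁴ programme, node NE3, row K6 of ruling ρ-g22-2, part K6c-1b-α of the cut ρ-g23-3 §3) — THE COARSE DATA OF
# THE S7 COMPETITOR AT `b := ψ = bmeanIterW ζ′` (NESTED), `c := ζ′` AT THE CORNERS, `U := cavgIter`: FOUR ℓ²-BOUNDS BY NAME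

NE3 (node U1b) formalisation swarm `b2b-balaban-t4-ne3-formalise-*`, leaf seat `b2b-balaban-t4-ne3-formalise-leaf-02` (gen 6), row **K6**
(booked → leaf-02 lineage; blueprint `HOME/t4/b2b-balaban-t4-ne3-p1/g23/D-ne3p1-g23-1.md` (S7)(S8); disprover D-ne3r2-g9-3 (4) «ALTERNATIVELY take
`b := bmeanIterW L k W ζ′` (nested) in f5 — then `c − b = −framePotW η′` exactly (H4-W alone)»).  The S7 competitor of leaf-01-g6's K5c f5
`NE3CovariantCompetitor.competitorW M W b c` is fed, in K6c-1b, with the coarse data `b := bmeanIterW L (k+1) W ζ′` (the NESTED transported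
block mean), `c z := ζ′ (M•z)` (the corner values) and the coarse background `U := cavgIter L (k+1) W`; its energy theorem
`sum_normSq_gaugeDir_competitorW_le` then asks for `D = Σ_zΣ_α ‖gaugeDir U b z α‖²`, `S_b = Σ_z ‖b z‖²`, `S_h = Σ_z ‖c z − b z‖²` (op-norm currency).
This file bounds the three, and the raw comb line sums, by the letters of the K6 budget.  All [folklore], 0 sorry, 0 def
(`M = L^{k+1}`, `h² = ΣΣ nhsNormSq η′`, `Z = Σ nhsNormSq ζ′` over `periodBox (L^{k+1}·N)`; `ℰ′` = K6b-3 `weightedEnergy_nonexact_le`'s right-hand side):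
§1 `sum_nhsNormSq_TWc_le` — THE TRIVIAL ℓ² BOUND OF THE CORNER-READ COMB LINE SUMS: `Σ_{z∈periodBox N}Σ_κ nhsNormSq (TWc L k W η z κ) ≤ M^{d+2}·ΣΣ nhsNormSq η`
   (`M^{d+1}` terms per coarse bond, unitary transports dropped (`nhsNormSq_Ad`), each fine value read `M` times: `sum_blocks_torus`, `sum_periodBox_shift`);
§2 `pow_mul_sum_normSq_gaugeDir_bmeanIterW_le` — `M^d·D ≤ card n·(2·M²·h² + 2·ℰ′)`: `‖gaugeDir U ψ z α‖² ≤ card n·nhsNormSq (cD U α ψ z)` (K6b-3 `Ad_gaugeDir_eq_neg_cD`,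
   `nhsNormSq_Ad`), `cD U ψ = ω − E` with `ω = M^{−d}•TWc η′` (§1) and `M^d·ΣΣ nhsNormSq E ≤ ℰ′` (K6b-3, on `T_♮(W)`);
§3 `pow_mul_sum_normSq_bmeanIterW_le` — `M^d·S_b ≤ card n·Z` (NE3-R2's Jensen `NE3NestedBlockMeanJensenHS.sum_nhsNormSq_bmeanIterW_le_one`);
§4 `sum_normSq_corner_sub_bmeanIterW_le` — `S_h = Σ_z ‖framePotW L (k+1) W η′ z‖² ≤ 48·(d·L)·(card n·h²)` (`3 ≤ d`): on `T_♮(W)` `framePotW Y = 0`, K0a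
   `NE3CovariantBlockMean.framePotW_gaugeDir` (`framePotW (gaugeDir W ζ′) z = ζ′(M•z) − ψ z`), additivity `NE3CurvedFrameKill.framePotW_add`, and leaf-04's H4-W♯
   `NE3FramePotBoundWSharp.sum_norm_framePotW_sq_le_sharp` (p234726, the sharpened box count `Dfp ↦ d·L`).
HONEST FRAMING.  Bookkeeping on OUR lattice objects at ONE unitary background in the tower's small-field class; nothing about Bałaban's
minimisers; (P♮)_W, (ML_w) at `W ≠ 1`, T-E_w and NE3 are NOT proved; spine PROVED 0∕9; finite T⁴ rung (B)+1 — NOT infinite volume, NOT mass gap,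
NOT BetaPertH, NOT Clay.  ABSOLUTE RULE kept: no printed sentence is a hypothesis (context only: [Balaban1985Averaging] (120)–(125);
[Balaban1985PropagatorsII] Thm 3.3 (3.46)).  PLACEMENT: `Summits/QuantumFields/BalabanUV/`; imports accepted modules only; moves nothing.
HONEST DEPENDENCY: continuum YM on T⁴ ⇐ BetaPertH ∧ nine spine estimates (0/9 proved); BetaPertH ⇐ (D1) ∧ (D4) ∧ CAP+tail; G-an2-4
gates asym, D1 and NE2/3/4.
-/

set_option autoImplicit false

open scoped BigOperators Matrix.Norms.L2Operator
open Finset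

namespace Summit.QuantumFields.BalabanUV.T4Continuum.NE3SlicePoincareCoarseData

open Literature.MathematicalPhysics.QuantumFieldTheory.Balaban1983to89
open B7Prop1Explicit B7Prop2Explicit MatrixNorms
open T4AveragingDeficitWall (IsUnitaryCfg IsSkewDir SmallField Ad)
open T4AveragingDeficitWallBoundary (IsPeriodicCfg periodBox card_periodBox sum_periodBox_shift)
open AveragingDeficitPeriodicCounting (IsPeriodicDir)
open AveragingDeficitHSInner (nhsNormSq_Ad nhsNormSq_smul)
open AveragingDeficitTwoLevelPrep (prop1Radius)
open AveragingDeficitMultiLevelPrep (cavgIter tower LevelSmall cavgIter_unitary_small)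
open SpreadLift (loopRad)
open BlockAveragePushDirGauge (gaugeDir)
open NE3CovariantCalculus (cD nhsNormSq_sub_le nhsNormSq_neg)
open NE3TangentCovariantTower (framePotW)
open NE3CovariantBlockMean (bmeanIterW framePotW_gaugeDir)
open NE3CurvedFrameKill (framePotW_add)
open NE3CovariantLineSumsL2 (l2sq)
open NE3CovariantLineSumsL2Tower (rho S2sum)
open NE3ExactLineSumsTower (DSum)
open NE3CovariantLineAdjoint (TWc combTransport combTransport_mem TWc_eq)
open NE3BlockPoincareCore (sum_blocks_torus)
open NE3CovariantLineSumCore (nhsNormSq_sum_le_card_mul)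
open NE3FrameFreeSliceW (frameFreeBlockLandauW)
open NE3FramePotBoundWSharp (sum_norm_framePotW_sq_le_sharp)
open NE3NestedBlockMeanJensenHS (sum_nhsNormSq_bmeanIterW_le_one)
open NE3SlicePoincareRemainderE (Ad_gaugeDir_eq_neg_cD weightedEnergy_nonexact_le sum_sum_norm_sq_le_card_mul)

noncomputable section

variable {d : ℕ} {n : Type*} [Fintype n] [DecidableEq n]

/-! ## §1 The trivial ℓ² bound of the corner-read comb line sums -/

/-- **`Σ_{z∈periodBox N} Σ_κ nhsNormSq (TWc L k W η z κ) ≤ M^{d+2}·Σ_{y∈periodBox (M·N)} Σ_κ nhsNormSq (η y κ)`** (`M = L^k ≥ 1`, `N ≥ 1`, unitary `W`,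
`η` `(M·N)`-periodic): Cauchy–Schwarz over the `M^d·M` transported copies (`nhsNormSq_Ad`: the transports are HS isometries), the block tiling
`sum_blocks_torus`, and the `M` periodic shifts `i•e_κ` (`sum_periodBox_shift`). [folklore] -/
theorem sum_nhsNormSq_TWc_le [Nonempty n] {L : ℕ} (hL : 1 ≤ L) (k : ℕ) {N : ℕ} (hN : 1 ≤ N)
    {W : Site d → Fin d → (Matrix n n ℂ)ˣ} (hW : IsUnitaryCfg W) {η : Site d → Fin d → Matrix n n ℂ}
    (hη : ∀ (x : Site d) (τ μ : Fin d), η (x + ((L ^ k * N : ℕ) : ℤ) • e τ) μ = η x μ) :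
    ∑ z ∈ periodBox (d := d) N, ∑ κ : Fin d, nhsNormSq (TWc L k W η z κ)
      ≤ (((L ^ k : ℕ) : ℝ)) ^ (d + 2) * ∑ y ∈ periodBox (d := d) (L ^ k * N), ∑ κ : Fin d, nhsNormSq (η y κ) := by
  have hM : 1 ≤ L ^ k := Nat.one_le_pow _ _ hL
  have hMN : 1 ≤ L ^ k * N := Nat.one_le_iff_ne_zero.2 (Nat.mul_ne_zero (by omega) (by omega))
  -- pointwise Cauchy–Schwarz with the unitary transports dropped
  have hpt : ∀ (z : Site d) (κ : Fin d), nhsNormSq (TWc L k W η z κ)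
      ≤ (((L ^ k : ℕ) : ℝ)) ^ (d + 1) * ∑ v ∈ periodBox (d := d) (L ^ k), ∑ i ∈ range (L ^ k),
          nhsNormSq (η ((((L ^ k : ℕ) : ℤ)) • z + v + (i : ℤ) • e κ) κ) := by
    intro z κ
    rw [TWc_eq]
    calc nhsNormSq (∑ v ∈ periodBox (d := d) (L ^ k), ∑ i ∈ range (L ^ k),
            Ad (combTransport W (L ^ k) z κ v (i + 1)) (η ((((L ^ k : ℕ) : ℤ)) • z + v + (i : ℤ) • e κ) κ))
        ≤ (periodBox (d := d) (L ^ k)).card * ∑ v ∈ periodBox (d := d) (L ^ k), nhsNormSq (∑ i ∈ range (L ^ k),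
            Ad (combTransport W (L ^ k) z κ v (i + 1)) (η ((((L ^ k : ℕ) : ℤ)) • z + v + (i : ℤ) • e κ) κ)) :=
          nhsNormSq_sum_le_card_mul _ _
      _ ≤ (periodBox (d := d) (L ^ k)).card * ∑ v ∈ periodBox (d := d) (L ^ k), ((range (L ^ k)).card
            * ∑ i ∈ range (L ^ k), nhsNormSq (η ((((L ^ k : ℕ) : ℤ)) • z + v + (i : ℤ) • e κ) κ)) := by
          gcongr with v hv
          refine (nhsNormSq_sum_le_card_mul _ _).trans (le_of_eq ?_)
          congr 1
          exact sum_congr rfl fun i _ => nhsNormSq_Ad (combTransport_mem hW _ _ _ _ _) _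
      _ = (((L ^ k : ℕ) : ℝ)) ^ (d + 1) * ∑ v ∈ periodBox (d := d) (L ^ k), ∑ i ∈ range (L ^ k),
            nhsNormSq (η ((((L ^ k : ℕ) : ℤ)) • z + v + (i : ℤ) • e κ) κ) := by
          rw [card_periodBox, card_range, ← mul_sum, ← mul_assoc]
          push_cast
          ring
  -- sum over the coarse bonds: tile, then shift
  have hκ : ∀ κ : Fin d, ∑ z ∈ periodBox (d := d) N, nhsNormSq (TWc L k W η z κ)
      ≤ (((L ^ k : ℕ) : ℝ)) ^ (d + 1) * ((L ^ k : ℕ) * ∑ x ∈ periodBox (d := d) (L ^ k * N), nhsNormSq (η x κ)) := by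
    intro κ
    have hblk : ∑ z ∈ periodBox (d := d) N, ∑ v ∈ periodBox (d := d) (L ^ k), ∑ i ∈ range (L ^ k),
          nhsNormSq (η ((((L ^ k : ℕ) : ℤ)) • z + v + (i : ℤ) • e κ) κ)
        = ∑ x ∈ periodBox (d := d) (L ^ k * N), ∑ i ∈ range (L ^ k), nhsNormSq (η (x + (i : ℤ) • e κ) κ) :=
      sum_blocks_torus hM N (fun x => ∑ i ∈ range (L ^ k), nhsNormSq (η (x + (i : ℤ) • e κ) κ))
    calc ∑ z ∈ periodBox (d := d) N, nhsNormSq (TWc L k W η z κ)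
        ≤ ∑ z ∈ periodBox (d := d) N, (((L ^ k : ℕ) : ℝ)) ^ (d + 1) * ∑ v ∈ periodBox (d := d) (L ^ k), ∑ i ∈ range (L ^ k),
            nhsNormSq (η ((((L ^ k : ℕ) : ℤ)) • z + v + (i : ℤ) • e κ) κ) := sum_le_sum fun z _ => hpt z κ
      _ = (((L ^ k : ℕ) : ℝ)) ^ (d + 1) * ∑ i ∈ range (L ^ k), ∑ x ∈ periodBox (d := d) (L ^ k * N), nhsNormSq (η (x + (i : ℤ) • e κ) κ) := by
          rw [← mul_sum, hblk, sum_comm]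
      _ = (((L ^ k : ℕ) : ℝ)) ^ (d + 1) * ∑ i ∈ range (L ^ k), ∑ x ∈ periodBox (d := d) (L ^ k * N), nhsNormSq (η x κ) := by
          congr 1
          refine sum_congr rfl fun i _ => ?_
          exact sum_periodBox_shift (L ^ k * N) hMN (g := fun x => nhsNormSq (η x κ)) (fun x τ => by simp only [hη]) ((i : ℤ) • e κ)
      _ = (((L ^ k : ℕ) : ℝ)) ^ (d + 1) * ((L ^ k : ℕ) * ∑ x ∈ periodBox (d := d) (L ^ k * N), nhsNormSq (η x κ)) := by
          rw [sum_const, card_range, nsmul_eq_mul]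
  calc ∑ z ∈ periodBox (d := d) N, ∑ κ : Fin d, nhsNormSq (TWc L k W η z κ)
      = ∑ κ : Fin d, ∑ z ∈ periodBox (d := d) N, nhsNormSq (TWc L k W η z κ) := sum_comm
    _ ≤ ∑ κ : Fin d, (((L ^ k : ℕ) : ℝ)) ^ (d + 1) * ((L ^ k : ℕ) * ∑ x ∈ periodBox (d := d) (L ^ k * N), nhsNormSq (η x κ)) :=
        sum_le_sum fun κ _ => hκ κ
    _ = (((L ^ k : ℕ) : ℝ)) ^ (d + 2) * ∑ y ∈ periodBox (d := d) (L ^ k * N), ∑ κ : Fin d, nhsNormSq (η y κ) := by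
        rw [← mul_sum, ← mul_sum, sum_comm]
        ring

/-! ## §2 The coarse covariant gradient of the nested block means: `M^d·D ≤ card n·(2M²h² + 2ℰ′)` -/

/-- `((L^d)⁻¹)^{k+1} = (((L^{k+1})^d)⁻¹` as reals. [folklore] -/
theorem inv_pow_pow_eq (L d k : ℕ) : (((L : ℝ) ^ d)⁻¹) ^ (k + 1) = (((L : ℝ) ^ (k + 1)) ^ d)⁻¹ := by
  rw [inv_pow, ← pow_mul, ← pow_mul, Nat.mul_comm d (k + 1)]

/-- **THE COARSE GRADIENT OF `ψ := bmeanIterW ζ′` AT `U := cavgIter`, THROUGH (E)**: for `Y ∈ T_♮(W) = frameFreeBlockLandauW L N (k+1) W` in the tower class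
and `Y = η′ + gaugeDir W ζ′` (η′, ζ′ of period `tower L N (k+1)`), with `M = L^{k+1}`,
`M^d · Σ_{z∈periodBox N} Σ_α ‖gaugeDir (cavgIter L (k+1) W) (bmeanIterW L (k+1) W ζ′) z α‖² ≤ card n · (2·M²·h² + 2·ℰ′)`,
`ℰ′` = K6b-3 `weightedEnergy_nonexact_le`'s right-hand side (`gaugeDir U ψ = −Ad U⁻¹ (cD U ψ)`, `cD U ψ = ω − E`, `ω = M^{−d}•TWc η′` and §1). [folklore] -/
theorem pow_mul_sum_normSq_gaugeDir_bmeanIterW_le [Nonempty n] {L N : ℕ} (hL : 2 ≤ L) (hN : 1 ≤ N) (k : ℕ)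
    {W : Site d → Fin d → (Matrix n n ℂ)ˣ} {x : ℝ} (hWu : IsUnitaryCfg W) (hWP : IsPeriodicCfg W ((tower L N (k + 1) : ℕ) : ℤ))
    (hx : 0 ≤ x) (hs : LevelSmall d L k x) (hWx : SmallField W x) (hS2 : S2sum d L (k + 1) x ≤ rho d L / 2)
    {Y : Site d → Fin d → Matrix n n ℂ} (hY : Y ∈ frameFreeBlockLandauW (d := d) (n := n) L N (k + 1) W)
    {η' : Site d → Fin d → Matrix n n ℂ} (hη'P : IsPeriodicDir η' ((tower L N (k + 1) : ℕ) : ℤ)) {ζ' : Site d → Matrix n n ℂ}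
    (hζ'P : ∀ (y : Site d) (τ : Fin d), ζ' (y + ((tower L N (k + 1) : ℕ) : ℤ) • e τ) = ζ' y)
    (hYeq : ∀ (y : Site d) (κ : Fin d), Y y κ = η' y κ + gaugeDir W ζ' y κ) :
    ((L : ℝ) ^ (k + 1)) ^ d * ∑ z ∈ periodBox (d := d) N, ∑ α : Fin d,
        ‖gaugeDir (cavgIter L (k + 1) W) (bmeanIterW L (k + 1) W ζ') z α‖ ^ 2
      ≤ (Fintype.card n : ℝ) *
        (2 * ((L : ℝ) ^ (k + 1)) ^ 2 * ∑ y ∈ periodBox (d := d) (L ^ (k + 1) * N), ∑ κ : Fin d, nhsNormSq (η' y κ)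
          + 2 * (4 * (2 * ((4 * d + 5) / 10 * DSum d L (k + 1) x)) ^ 2 * ((L : ℝ) ^ (k + 1)) ^ 2
                    * ((Fintype.card n : ℝ) * ∑ y ∈ periodBox (d := d) (L ^ (k + 1) * N), ∑ κ : Fin d, nhsNormSq (η' y κ))
                  + 16 * S2sum d L (k + 1) x ^ 2 * ((L : ℝ) ^ d * ((L : ℝ) ^ k) ^ 2)
                    * ((Fintype.card n : ℝ) * ∑ y ∈ periodBox (d := d) (L ^ (k + 1) * N), ∑ κ : Fin d, nhsNormSq (Y y κ))
                  + 2 * ((d : ℝ) * (20 * loopRad d L ((prop1Radius d L)^[k] x)) ^ 2)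
                    * ((Fintype.card n : ℝ) * ∑ y ∈ periodBox (d := d) (L ^ (k + 1) * N), nhsNormSq (ζ' y)))) := by
  haveI : NeZero N := ⟨by omega⟩
  have hL1 : 1 ≤ L := le_trans (by norm_num) hL
  have htow : tower L N (k + 1) = L ^ (k + 1) * N := NE3CurvedProjectedLandau.tower_eq_pow_mul L N (k + 1)
  have hM0 : (0 : ℝ) < (L : ℝ) ^ (k + 1) := by
    have : (0 : ℝ) < L := by exact_mod_cast (by omega : 0 < L)
    positivity
  have hMR : (((L ^ (k + 1) : ℕ) : ℝ)) = (L : ℝ) ^ (k + 1) := by push_cast; ring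
  have hU := (cavgIter_unitary_small (d := d) hL1 k hWu hx hs hWx).1
  have hη'M : ∀ (y : Site d) (τ μ : Fin d), η' (y + ((L ^ (k + 1) * N : ℕ) : ℤ) • e τ) μ = η' y μ := by
    intro y τ μ; rw [← htow]; exact hη'P y τ μ
  -- names
  set U := cavgIter L (k + 1) W with hUdef
  set ψ := bmeanIterW L (k + 1) W ζ' with hψdef
  set E : Site d → Fin d → Matrix n n ℂ := fun z μ =>
    (((L : ℝ) ^ d)⁻¹) ^ (k + 1) • TWc L (k + 1) W η' z μ - cD U μ ψ z with hEdef
  -- K6b-3 and §1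
  have hℰ := weightedEnergy_nonexact_le hL hN k hWu hWP hx hs hWx hS2 hY hη'P hζ'P hYeq
  rw [htow] at hℰ
  have hT := sum_nhsNormSq_TWc_le hL1 (k + 1) hN hWu hη'M
  rw [hMR] at hT
  -- pointwise: `‖gaugeDir U ψ z α‖² ≤ card n·(2·nhsNormSq ω + 2·nhsNormSq E)`
  have hpt : ∀ (z : Site d) (α : Fin d), ‖gaugeDir U ψ z α‖ ^ 2
      ≤ (Fintype.card n : ℝ) * (2 * (nhsNormSq ((((L : ℝ) ^ d)⁻¹) ^ (k + 1) • TWc L (k + 1) W η' z α) + nhsNormSq (E z α))) := by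
    intro z α
    have h1 := opNorm_sq_le_card_mul_nhsNormSq (gaugeDir U ψ z α)
    have h2 : nhsNormSq (gaugeDir U ψ z α) = nhsNormSq (cD U α ψ z) := by
      rw [← nhsNormSq_Ad (hU z α), Ad_gaugeDir_eq_neg_cD, nhsNormSq_neg]
    have h3 : cD U α ψ z = (((L : ℝ) ^ d)⁻¹) ^ (k + 1) • TWc L (k + 1) W η' z α - E z α := by
      simp only [hEdef, sub_sub_cancel]
    have h4 := nhsNormSq_sub_le ((((L : ℝ) ^ d)⁻¹) ^ (k + 1) • TWc L (k + 1) W η' z α) (E z α)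
    rw [h2, h3] at h1
    have hn : (0 : ℝ) ≤ Fintype.card n := by positivity
    nlinarith [mul_le_mul_of_nonneg_left h4 hn]
  -- sum and weigh
  have hsum : ∑ z ∈ periodBox (d := d) N, ∑ α : Fin d, ‖gaugeDir U ψ z α‖ ^ 2
      ≤ (Fintype.card n : ℝ) * (2 * ((((L : ℝ) ^ d)⁻¹) ^ (k + 1)) ^ 2
            * ∑ z ∈ periodBox (d := d) N, ∑ α : Fin d, nhsNormSq (TWc L (k + 1) W η' z α)
          + 2 * ∑ z ∈ periodBox (d := d) N, ∑ α : Fin d, nhsNormSq (E z α)) := by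
    calc ∑ z ∈ periodBox (d := d) N, ∑ α : Fin d, ‖gaugeDir U ψ z α‖ ^ 2
        ≤ ∑ z ∈ periodBox (d := d) N, ∑ α : Fin d,
            (Fintype.card n : ℝ) * (2 * (nhsNormSq ((((L : ℝ) ^ d)⁻¹) ^ (k + 1) • TWc L (k + 1) W η' z α) + nhsNormSq (E z α))) :=
          sum_le_sum fun z _ => sum_le_sum fun α _ => hpt z α
      _ = _ := by
          simp only [nhsNormSq_smul, mul_add, mul_sum, sum_add_distrib]
          ring_nf
  have hscal : ((L : ℝ) ^ (k + 1)) ^ d * ((((L : ℝ) ^ d)⁻¹) ^ (k + 1)) ^ 2 * (((L : ℝ) ^ (k + 1)) ^ (d + 2))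
      = ((L : ℝ) ^ (k + 1)) ^ 2 := by
    rw [inv_pow_pow_eq]
    field_simp
    ring
  have hMd : (0 : ℝ) ≤ ((L : ℝ) ^ (k + 1)) ^ d := by positivity
  have hc2 : (0 : ℝ) ≤ ((L : ℝ) ^ (k + 1)) ^ d * ((((L : ℝ) ^ d)⁻¹) ^ (k + 1)) ^ 2 := by positivity
  have hn : (0 : ℝ) ≤ Fintype.card n := by positivity
  -- `M^d·c²·ΣΣ nhsNormSq TWc ≤ M²·h²`
  have hω : ((L : ℝ) ^ (k + 1)) ^ d * (((((L : ℝ) ^ d)⁻¹) ^ (k + 1)) ^ 2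
        * ∑ z ∈ periodBox (d := d) N, ∑ α : Fin d, nhsNormSq (TWc L (k + 1) W η' z α))
      ≤ ((L : ℝ) ^ (k + 1)) ^ 2 * ∑ y ∈ periodBox (d := d) (L ^ (k + 1) * N), ∑ κ : Fin d, nhsNormSq (η' y κ) := by
    have h := mul_le_mul_of_nonneg_left hT hc2
    rw [← mul_assoc, ← hscal]
    linarith [h]
  have hmain := mul_le_mul_of_nonneg_left hsum hMd
  nlinarith [hmain, hω, hℰ, hn, mul_le_mul_of_nonneg_left hω hn, mul_le_mul_of_nonneg_left hℰ hn]

/-! ## §3 The mass of the nested block means: `M^d·S_b ≤ card n·Z` -/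

/-- **`M^d · Σ_{z∈periodBox N} ‖bmeanIterW L (k+1) W ζ′ z‖² ≤ card n · Σ_{y∈periodBox (M·N)} nhsNormSq (ζ′ y)`** (op ≤ `card n`·nhs pointwise, then
NE3-R2's Jensen-HS `sum_nhsNormSq_bmeanIterW_le_one`). [folklore] -/
theorem pow_mul_sum_normSq_bmeanIterW_le [Nonempty n] {L : ℕ} (hL : 1 ≤ L) (k : ℕ) {W : Site d → Fin d → (Matrix n n ℂ)ˣ} {x : ℝ}
    (hWu : IsUnitaryCfg W) (hx : 0 ≤ x) (hs : LevelSmall d L k x) (hWx : SmallField W x) (ζ' : Site d → Matrix n n ℂ) (N : ℕ) :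
    ((L : ℝ) ^ (k + 1)) ^ d * ∑ z ∈ periodBox (d := d) N, ‖bmeanIterW L (k + 1) W ζ' z‖ ^ 2
      ≤ (Fintype.card n : ℝ) * ∑ y ∈ periodBox (d := d) (L ^ (k + 1) * N), nhsNormSq (ζ' y) := by
  have hJ := sum_nhsNormSq_bmeanIterW_le_one hL k hWu hx hs hWx ζ' N
  have hn : (0 : ℝ) ≤ Fintype.card n := by positivity
  calc ((L : ℝ) ^ (k + 1)) ^ d * ∑ z ∈ periodBox (d := d) N, ‖bmeanIterW L (k + 1) W ζ' z‖ ^ 2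
      ≤ ((L : ℝ) ^ (k + 1)) ^ d * ∑ z ∈ periodBox (d := d) N, (Fintype.card n : ℝ) * nhsNormSq (bmeanIterW L (k + 1) W ζ' z) := by
        gcongr with z hz
        exact opNorm_sq_le_card_mul_nhsNormSq _
    _ = (Fintype.card n : ℝ) * ∑ z ∈ periodBox (d := d) N, ((L : ℝ) ^ (k + 1)) ^ d * nhsNormSq (bmeanIterW L (k + 1) W ζ' z) := by
        rw [mul_sum, mul_sum]
        exact sum_congr rfl fun z _ => by ring
    _ ≤ (Fintype.card n : ℝ) * ∑ y ∈ periodBox (d := d) (L ^ (k + 1) * N), nhsNormSq (ζ' y) := mul_le_mul_of_nonneg_left hJ hn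

/-! ## §4 The spike heights `ζ′(M•z) − ψ z = −framePotW η′ z` on `T_♮(W)`, and H4-W -/

/-- **ON `T_♮(W)` THE SPIKE HEIGHTS ARE THE FRAMES OF `η′`**: for `Y ∈ frameFreeBlockLandauW L N (k+1) W` in the tower class and `Y = η′ + gaugeDir W ζ′`
(ζ′ 𝔲(n)-valued, of period `tower L N (k+1)`), `ζ′ ((L^{k+1})•z) − bmeanIterW L (k+1) W ζ′ z = −framePotW L (k+1) W η′ z`
(`framePotW Y = 0`, K0a `framePotW_gaugeDir`, additivity `framePotW_add`). [folklore] -/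
theorem corner_sub_bmeanIterW_eq [Nonempty n] {L N : ℕ} (hL : 2 ≤ L) (hN : 1 ≤ N) (k : ℕ)
    {W : Site d → Fin d → (Matrix n n ℂ)ˣ} {x : ℝ} (hWu : IsUnitaryCfg W) (hWP : IsPeriodicCfg W ((tower L N (k + 1) : ℕ) : ℤ))
    (hx : 0 ≤ x) (hs : LevelSmall d L k x) (hWx : SmallField W x)
    {Y : Site d → Fin d → Matrix n n ℂ} (hY : Y ∈ frameFreeBlockLandauW (d := d) (n := n) L N (k + 1) W)
    {η' : Site d → Fin d → Matrix n n ℂ} {ζ' : Site d → Matrix n n ℂ}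
    (hζ'P : ∀ (y : Site d) (τ : Fin d), ζ' (y + ((tower L N (k + 1) : ℕ) : ℤ) • e τ) = ζ' y)
    (hζ's : ∀ y : Site d, ζ' y ∈ skewAdjoint (Matrix n n ℂ))
    (hYeq : ∀ (y : Site d) (κ : Fin d), Y y κ = η' y κ + gaugeDir W ζ' y κ) (z : Site d) :
    ζ' ((((L ^ (k + 1) : ℕ) : ℤ)) • z) - bmeanIterW L (k + 1) W ζ' z = -framePotW L (k + 1) W η' z := by
  haveI : NeZero N := ⟨by omega⟩
  have hL1 : 1 ≤ L := le_trans (by norm_num) hL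
  have hK0 := framePotW_gaugeDir (M := N) hL1 k hWu hWP hx hs hWx hζ's hζ'P z
  have hcast : ((L : ℤ) ^ (k + 1)) = (((L ^ (k + 1) : ℕ) : ℤ)) := by push_cast; ring
  rw [hcast] at hK0
  have hYfun : Y = fun y ν => η' y ν + gaugeDir W ζ' y ν := funext fun y => funext fun ν => hYeq y ν
  have hadd := framePotW_add hL1 k hWu hx hs hWx η' (gaugeDir W ζ') z
  rw [← hYfun, hY.2.2.2.1 z, hK0] at hadd
  exact eq_neg_of_add_eq_zero_right hadd.symm

/-- **THE SPIKE HEIGHTS IN ℓ², BY H4-W** (`3 ≤ d`; tower class with `S2sum d L (k+1) x ≤ ρ∕2`; η′ of period `tower L N (k+1)`):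
`Σ_{z∈periodBox N} ‖ζ′((L^{k+1})•z) − bmeanIterW L (k+1) W ζ′ z‖² ≤ 48·(d·L)·(card n·Σ_{y∈periodBox (L^{k+1}·N)}Σ_κ nhsNormSq (η′ y κ))`
(`corner_sub_bmeanIterW_eq` + leaf-04's H4-W♯ `NE3FramePotBoundWSharp.sum_norm_framePotW_sq_le_sharp` + op ≤ `card n`·nhs). [folklore] -/
theorem sum_normSq_corner_sub_bmeanIterW_le [Nonempty n] (hd : 3 ≤ d) {L N : ℕ} (hL : 2 ≤ L) (hN : 1 ≤ N) (k : ℕ)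
    {W : Site d → Fin d → (Matrix n n ℂ)ˣ} {x : ℝ} (hWu : IsUnitaryCfg W) (hWP : IsPeriodicCfg W ((tower L N (k + 1) : ℕ) : ℤ))
    (hx : 0 ≤ x) (hs : LevelSmall d L k x) (hWx : SmallField W x) (hS2 : S2sum d L (k + 1) x ≤ rho d L / 2)
    {Y : Site d → Fin d → Matrix n n ℂ} (hY : Y ∈ frameFreeBlockLandauW (d := d) (n := n) L N (k + 1) W)
    {η' : Site d → Fin d → Matrix n n ℂ} (hη'P : IsPeriodicDir η' ((tower L N (k + 1) : ℕ) : ℤ)) {ζ' : Site d → Matrix n n ℂ}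
    (hζ'P : ∀ (y : Site d) (τ : Fin d), ζ' (y + ((tower L N (k + 1) : ℕ) : ℤ) • e τ) = ζ' y)
    (hζ's : ∀ y : Site d, ζ' y ∈ skewAdjoint (Matrix n n ℂ))
    (hYeq : ∀ (y : Site d) (κ : Fin d), Y y κ = η' y κ + gaugeDir W ζ' y κ) :
    ∑ z ∈ periodBox (d := d) N, ‖ζ' ((((L ^ (k + 1) : ℕ) : ℤ)) • z) - bmeanIterW L (k + 1) W ζ' z‖ ^ 2
      ≤ 48 * ((d : ℝ) * L) * ((Fintype.card n : ℝ) * ∑ y ∈ periodBox (d := d) (L ^ (k + 1) * N), ∑ κ : Fin d, nhsNormSq (η' y κ)) := by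
  have htow : tower L N (k + 1) = L ^ (k + 1) * N := NE3CurvedProjectedLandau.tower_eq_pow_mul L N (k + 1)
  have hWP' : IsPeriodicCfg W ((L ^ (k + 1) * N : ℕ) : ℤ) := by rw [← htow]; exact hWP
  have hη'P' : IsPeriodicDir η' ((L ^ (k + 1) * N : ℕ) : ℤ) := by rw [← htow]; exact hη'P
  have hH4 := sum_norm_framePotW_sq_le_sharp hd hL hN k hWu hWP' hx hs hWx hS2 hη'P'
  have hl2 : l2sq (periodBox (d := d) (L ^ (k + 1) * N)) η'
      ≤ (Fintype.card n : ℝ) * ∑ y ∈ periodBox (d := d) (L ^ (k + 1) * N), ∑ κ : Fin d, nhsNormSq (η' y κ) :=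
    sum_sum_norm_sq_le_card_mul _ _
  have hD : 0 ≤ 48 * ((d : ℝ) * L) := by positivity
  calc ∑ z ∈ periodBox (d := d) N, ‖ζ' ((((L ^ (k + 1) : ℕ) : ℤ)) • z) - bmeanIterW L (k + 1) W ζ' z‖ ^ 2
      = ∑ z ∈ periodBox (d := d) N, ‖framePotW L (k + 1) W η' z‖ ^ 2 := by
        refine sum_congr rfl fun z _ => ?_
        rw [corner_sub_bmeanIterW_eq hL hN k hWu hWP hx hs hWx hY hζ'P hζ's hYeq z, norm_neg]
    _ ≤ 48 * ((d : ℝ) * L) * l2sq (periodBox (d := d) (L ^ (k + 1) * N)) η' := hH4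
    _ ≤ 48 * ((d : ℝ) * L) * ((Fintype.card n : ℝ) * ∑ y ∈ periodBox (d := d) (L ^ (k + 1) * N), ∑ κ : Fin d, nhsNormSq (η' y κ)) :=
        mul_le_mul_of_nonneg_left hl2 hD

end

end Summit.QuantumFields.BalabanUV.T4Continuum.NE3SlicePoincareCoarseData
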